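import Summits.Ventures.YMGap.Conjectures.StrongCouplingChiralLROMesonWeightInfraredBoundN
import Summits.Ventures.YMGap.Conjectures.StrongCouplingGaussianCorrectedCertAllColours
import HarnessLib
import HarnessLib.Audit.Tags

/-!
# `SalmhoferSeilerSmallBeta` (Y3) is a theorem: chiral long-range order of the strongly coupled `U(N)`
# lattice gauge theory with massless staggered fermions, `1 ≤ N ≤ 4`, `ν ≥ 4`, at small `β > 0`,
# uniformly in the volume

Cell `pub-ymgap`, seat qcd-lit g22 (literature-prover), `bears_on: Q1` — the typed node
`@[conjecture] def SalmhoferSeilerSmallBeta` of `Conjectures/StrongCouplingChiralLRO.lean`.  Everything is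
a theorem (0 facts, 0 sorry).

The proof is Salmhofer–Seiler's `β = 0` proof (Thm. 4.8, Cor. 4.9: infrared bound + Schwinger–Dyson
equation + `S(ν) < 0.35`, `K(N)`), run at `β > 0`:
* row S4 (Schwinger–Dyson half, continuous in `β`): `schwingerDysonBound_smallBeta`;
* row S3 (the infrared bound (IR)_{β,4N} at EVERY `β ≥ 0`, uniformly in `L`): Fröhlich–Israel–Lieb–Simon
  Gaussian domination for the `β`-dressed meson weight (`…ChiralLROMesonWeight*`), whose background weight
  is reflection positive for every plane because the Gaussian-corrected one-link factor of the `U(N)`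
  theory is a sum of hermitian squares — the explicit all-colour certificate
  `GaussCorrAllColours.hermSqCert : HermSqCert N (1/4N)` (`…GaussianCorrectedCertAllColours`:
  `¼·1 − (1/4N)·J ⪰ 0`), fed to `gaussCorrectedN_reflection_positivity`;
* the lattice lemma `kernel_chiralLRO_uniform` and the margin `zeroCoupling_margin`.

**`infraredBound`** — (IR)_{β,4N} for every `N ≥ 1`, `β ≥ 0`, even `L`; **`chiralLRO`** — the conjunct `N`
of Y3 for every `1 ≤ N ≤ 4`; **`salmhoferSeilerSmallBeta_holds : SalmhoferSeilerSmallBeta`**.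

Honest framing: this is the lattice statement Y3 exactly as typed (finite even tori `(ℤ/Lℤ)^ν`, `ν ≥ 4`,
`U(N)` with `1 ≤ N ≤ 4`, ONE staggered fermion, `m = 0`, `0 ≤ β < β₀(N, ν)`, LRO `≥ c` for `L ≥ L₀`); the
`β > 0` extension is NOT IN PRINT (Salmhofer–Seiler state it as an expectation for `N = 1`, §5 p. 424).
Nothing about `SU(3)`, several flavours, Wilson fermions, the continuum limit, or a mass gap — the
summit's `QCD` conjunct is untouched.

## References
* [SalmhoferSeiler1991] M. Salmhofer, E. Seiler, Commun. Math. Phys. 139 (1991) 395–432, Thm. 3.21,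
  Remark 4.5, Thm. 4.8, Cor. 4.9, §5 p. 424.
* [FrohlichIsraelLiebSimon1978] J. Fröhlich, R. Israel, E. H. Lieb, B. Simon, Commun. Math. Phys. 62 (1978) 1–34.
-/

noncomputable section

open Literature.MathematicalPhysics.QuantumLattice
open Literature.MathematicalPhysics.QuantumLattice.StrongCoupling
open Literature.MathematicalPhysics.StatisticalMechanics
open Literature.MathematicalPhysics.StatisticalMechanics.ComplexSpin
open Literature.Probability.LatticeModels (TorusSite)

namespace Summit.Ventures.YMGap.Conjectures

namespace MesonWeight

variable {N ν L : ℕ} [NeZero L]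

/-- **(IR)_{β,4N} FOR THE `U(N)` THEORY WITH ONE STAGGERED FERMION, EVERY `N ≥ 1`, AT EVERY `β ≥ 0`,
UNIFORMLY IN THE VOLUME**: `2(ν − C(χ))·Re T̂_β(χ) ≤ 4N` and `−2(ν + C(χ))·Re T̂_β(χ) ≤ 4N` for the
conjecture's kernel `T_β = ssTwoPoint N ν L β 0` and every character `χ` of the even torus. [cite: SalmhoferSeiler1991, Thm. 3.21 with (3.112)–(3.113) and Remark 4.5] -/
theorem infraredBound [NeZero ν] (hN : N ≠ 0) (hL : Even L) {β : ℝ} (hβ : 0 ≤ β) (χ : AddChar (TorusSite ν L) ℂ) :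
    2 * ((ν : ℝ) - cosSum χ) * (kernelSymbol (fun x y => ssTwoPoint N ν L β 0 x y) χ).re ≤ 4 * N ∧
      2 * ((ν : ℝ) + cosSum χ) * (-(kernelSymbol (fun x y => ssTwoPoint N ν L β 0 x y) χ).re) ≤ 4 * N :=
  infraredBound_N' (GaussCorrAllColours.hermSqCert hN) hN hL hβ χ

/-- **CHIRAL LONG-RANGE ORDER FOR THE `U(N)` THEORY, `1 ≤ N ≤ 4`, `ν ≥ 4`, AT SMALL `β > 0`, UNIFORMLY IN
THE VOLUME** — the conjunct `N` of `SalmhoferSeilerSmallBeta`. [cite: SalmhoferSeiler1991, Thm. 4.8 and Cor. 4.9 with (4.41)–(4.42), Remark 4.5] -/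
theorem chiralLRO (hN1 : 1 ≤ N) (hN4 : N ≤ 4) (hν : 4 ≤ ν) :
    ∃ β₀ : ℝ, 0 < β₀ ∧ ∃ c : ℝ, 0 < c ∧ ∃ L₀ : ℕ, ∀ β : ℝ, 0 ≤ β → β < β₀ →
      ∀ (L : ℕ) [NeZero L], Even L → L₀ ≤ L → c ≤ ssChiralOrder N ν L β :=
  chiralLRO_of_cert (GaussCorrAllColours.hermSqCert (N := N) (by omega)) rfl hN1 hN4 hν

end MesonWeight

/-- **Y3 IS A THEOREM: `SalmhoferSeilerSmallBeta` holds.**  For every `1 ≤ N ≤ 4` and `ν ≥ 4` there are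
`β₀ > 0`, `c > 0`, `L₀` with `|Λ_L|⁻¹ ∑_x ⟨ψ̄ψ(0)ψ̄ψ(x)⟩_{Λ_L, β, m=0} ≥ c` for all `0 ≤ β < β₀` and all
even `L ≥ L₀`. [cite: SalmhoferSeiler1991, Thm. 4.8, Cor. 4.9, Remark 4.5 and §5 p. 424] -/
theorem salmhoferSeilerSmallBeta_holds : SalmhoferSeilerSmallBeta :=
  fun _ _ hN1 hN4 hν => MesonWeight.chiralLRO hN1 hN4 hν

end Summit.Ventures.YMGap.Conjectures

end
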